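import Literature.Probability.NegativeDependence.TotallyPositiveGKK
import HarnessLib

/-!
# The Gantmacher–Krein–Carlson criterion and the local form (3.4) of the Hadamard–Fischer–Kotelyansky
# inequalities for P-matrices (Borcea–Brändén–Liggett §3.2; Fallat–Johnson Thm. 6.0.1)

J. Borcea, P. Brändén, T. M. Liggett, *Negative dependence and the geometry of polynomials*, J. Amer. Math. Soc.
22 (2009) 521–567 (arXiv:0707.2340, held `paper:arxiv-0707.2340`, arXiv numbering), §3.2 (arXiv pp. 11–12),
verbatim:

> Given an `n × n` matrix `A` and two subsets `S, T ⊆ [n]` of the same size we let `A(S,T)` denote the minor of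
> `A` lying in rows indexed by `S` and columns indexed by `T`. It was proved by Gantmacher–Krein [GK] and Carlson
> [Ca] that a necessary and sufficient condition for a P-matrix to be GKK is that
> `A(S,T) A(T,S) ≥ 0` for any `S, T ⊆ [n]` with `|S| = |T| = |S ∪ T| − 1`.
> […] It is known [Ca, GK] that an `n × n` P-matrix `C` is GKK if and only if
> `C⟨S ∪ {i}⟩ · C⟨S ∪ {j}⟩ ≥ C⟨S ∪ {i,j}⟩ · C⟨S⟩` (3.4) for all `S ⊆ [n]` and `i, j ∈ [n] ∖ S` with `i ≠ j`.

S. M. Fallat, C. R. Johnson, *Totally Nonnegative Matrices*, §6.0 (p. 127), verbatim: «**Theorem 6.0.1** Suppose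
`A` is an `n`-by-`n` `P_0`-matrix. Then `A` satisfies (6.4) [`det A[S ∪ T] · det A[S ∩ T] ≤ det A[S] · det A[T]`]
for all index sets `U, V` satisfying (1) and (2) above if and only if `A` satisfies (6.5)
[`det A[U,V] det A[V,U] ≥ 0`, `|U| = |V|`, `|U ∪ V| = |U ∩ V| + 1`] for all index sets `S, T`.»

## What is here (P-matrices, `IsPMatrix A`: all principal minors `principalMinorMap A S = det A[S]` positive;
## `coMinorWeight A S = A⟨S⟩ = det A[Sᶜ]`; `IsGKK`; an almost-principal pair `U = S ∪ {i}`, `V = S ∪ {j}` is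
## enumerated «`S`, then the extra index», `det A[S∪i | S∪j] = det (A.submatrix (S, i) (S, j))` — the PRODUCT
## `det A[U,V] · det A[V,U]` does not depend on the enumerations, `det_submatrix_mul_swap_reindex`)

* `det_submatrix_mul_swap_reindex` — re-enumerating `U` and `V` does not change `det A[U,V] · det A[V,U]`.
* **`isGKK_iff_local`** — (3.4) ⟺ GKK for P-matrices, in the `det A[·]` form
  `det A[S] det A[S ∪ {i,j}] ≤ det A[S ∪ i] det A[S ∪ j]`, and **`isGKK_iff_bbl_3_4`** — literally (3.4) with the
  co-minors `A⟨·⟩` ([Ca, GK]; ⟸ is Koteljanskiĭ's chain lemma `mul_union_inter_le_of_local`, ⟹ is the special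
  case `(S ∪ i, S ∪ j)` of the Hadamard–Fischer–Kotelyansky inequalities).
* **`isGKK_iff_almostPrincipalMinors_nonneg`** — THE GANTMACHER–KREIN–CARLSON CRITERION / Thm. 6.0.1 for
  P-matrices: `A` is GKK iff `det A[S∪i | S∪j] · det A[S∪j | S∪i] ≥ 0` for all `S` and `i ≠ j` outside `S`
  (the two-bordered Sylvester identity `principalMinorMap_insert_mul_insert_sub` makes the local inequality of
  (3.4) EQUIVALENT to the sign condition (6.5)).

Theorems only (no definition, no named fact). Scope: P-matrices (as in BBL); Fallat–Johnson's `P_0` version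
(non-strict principal minors) needs a limiting argument and is not formalised here. -- TODO(general form): P₀.

## References

* [BorceaBrandenLiggett2007] — §3.2 (Gantmacher–Krein–Carlson criterion; (3.4)).
* [FallatJohnson2011] — §6.0 (6.4), (6.5), Thm. 6.0.1; §1.2 (1.5).
-/

noncomputable section

open Finset Matrix
open Literature.LinearAlgebra.Matrix

namespace Literature.Probability.NegativeDependence

variable {n : Type*} [Fintype n] [DecidableEq n]

/-! ## §1 The product of two symmetrically placed minors does not depend on the enumerations -/

omit [Fintype n] [DecidableEq n] in
/-- Re-enumerating the row set by `α` and the column set by `β` multiplies `det A[U,V]` and `det A[V,U]` by the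
same sign `sgn α · sgn β`, so their product is unchanged. [cite: FallatJohnson2011, §6.0 (6.5) (the condition
on `det A[U,V] det A[V,U]`)] -/
theorem det_submatrix_mul_swap_reindex {R : Type*} [CommRing R] {m : Type*} [Fintype m] [DecidableEq m]
    (A : Matrix n n R) (r c : m → n) (α β : Equiv.Perm m) :
    (A.submatrix (r ∘ α) (c ∘ β)).det * (A.submatrix (c ∘ β) (r ∘ α)).det =
      (A.submatrix r c).det * (A.submatrix c r).det := by
  have h1 : A.submatrix (r ∘ α) (c ∘ β) = ((A.submatrix r c).submatrix α id).submatrix id β := by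
    simp only [submatrix_submatrix]; rfl
  have h2 : A.submatrix (c ∘ β) (r ∘ α) = ((A.submatrix c r).submatrix β id).submatrix id α := by
    simp only [submatrix_submatrix]; rfl
  rw [h1, h2, det_permute', det_permute, det_permute', det_permute]
  have hα : ((Equiv.Perm.sign α : ℤ) : R) * ((Equiv.Perm.sign α : ℤ) : R) = 1 := by
    rw [← Int.cast_mul, ← Units.val_mul, Int.units_mul_self, Units.val_one, Int.cast_one]
  have hβ : ((Equiv.Perm.sign β : ℤ) : R) * ((Equiv.Perm.sign β : ℤ) : R) = 1 := by
    rw [← Int.cast_mul, ← Units.val_mul, Int.units_mul_self, Units.val_one, Int.cast_one]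
  linear_combination ((Equiv.Perm.sign α : ℤ) : R) * ((Equiv.Perm.sign α : ℤ) : R) * (A.submatrix r c).det *
      (A.submatrix c r).det * hβ + (A.submatrix r c).det * (A.submatrix c r).det * hα

/-! ## §2 (3.4) ⟺ GKK for P-matrices -/

section Local

variable {A : Matrix n n ℝ}

/-- **«A P-matrix `C` is GKK if and only if (3.4) holds»** [Ca, GK], principal-minor form: for a P-matrix, the
Hadamard–Fischer–Kotelyansky inequalities hold iff `det A[S] · det A[S ∪ {i,j}] ≤ det A[S ∪ i] · det A[S ∪ j]`
for all `S` and `i ≠ j` outside `S`. [cite: BorceaBrandenLiggett2007, §3.2 eq. (3.4) ([Ca, GK]); FallatJohnson2011,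
§6.0 Thm. 6.0.1] -/
theorem isGKK_iff_local (hP : IsPMatrix A) :
    IsGKK A ↔ ∀ (S : Finset n) (i j : n), i ≠ j → i ∉ S → j ∉ S →
      principalMinorMap A S * principalMinorMap A (insert i (insert j S)) ≤
        principalMinorMap A (insert i S) * principalMinorMap A (insert j S) := by
  constructor
  · rintro ⟨-, h⟩ S i j hij hi hj
    have key := h (insert i S)ᶜ (insert j S)ᶜ
    rw [coMinorWeight_apply, coMinorWeight_apply, coMinorWeight_apply, coMinorWeight_apply, compl_union,
      compl_inter, compl_compl, compl_compl] at key
    have e1 : insert i S ∩ insert j S = S := by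
      ext x
      simp only [mem_inter, mem_insert]
      constructor
      · rintro ⟨rfl | hx, h' | hx'⟩
        · exact absurd h' hij
        · exact absurd hx' hi
        · exact hx
        · exact hx
      · exact fun hx => ⟨Or.inr hx, Or.inr hx⟩
    have e2 : insert i S ∪ insert j S = insert i (insert j S) := by
      ext x; simp only [mem_union, mem_insert]; tauto
    rw [e1, e2] at key
    linarith
  · intro h
    refine ⟨hP, fun S T => ?_⟩
    rw [coMinorWeight_apply, coMinorWeight_apply, coMinorWeight_apply, coMinorWeight_apply, compl_union,
      compl_inter, mul_comm]
    exact mul_union_inter_le_of_local hP h Sᶜ Tᶜ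

/-- **(3.4) as printed**, with the co-minors `C⟨S⟩ = det C[Sᶜ]`: a P-matrix `C` is GKK iff
`C⟨S ∪ {i}⟩ · C⟨S ∪ {j}⟩ ≥ C⟨S ∪ {i,j}⟩ · C⟨S⟩` for all `S` and `i ≠ j` outside `S`.
[cite: BorceaBrandenLiggett2007, §3.2 eq. (3.4) ([Ca, GK])] -/
theorem isGKK_iff_bbl_3_4 (hP : IsPMatrix A) :
    IsGKK A ↔ ∀ (S : Finset n) (i j : n), i ≠ j → i ∉ S → j ∉ S →
      coMinorWeight A (insert i (insert j S)) * coMinorWeight A S ≤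
        coMinorWeight A (insert i S) * coMinorWeight A (insert j S) := by
  constructor
  · rintro ⟨-, h⟩ S i j hij hi hj
    have key := h (insert i S) (insert j S)
    have e1 : insert i S ∩ insert j S = S := by
      ext x
      simp only [mem_inter, mem_insert]
      constructor
      · rintro ⟨rfl | hx, h' | hx'⟩
        · exact absurd h' hij
        · exact absurd hx' hi
        · exact hx
        · exact hx
      · exact fun hx => ⟨Or.inr hx, Or.inr hx⟩
    have e2 : insert i S ∪ insert j S = insert i (insert j S) := by
      ext x; simp only [mem_union, mem_insert]; tauto
    rwa [e1, e2] at key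
  · intro h
    rw [isGKK_iff_local hP]
    intro S i j hij hi hj
    -- (3.4) at the complementary set `T = (S ∪ {i,j})ᶜ` with the roles of `i` and `j` exchanged
    set T := (insert i (insert j S))ᶜ with hT
    have hTc : Tᶜ = insert i (insert j S) := by rw [hT, compl_compl]
    have hiT : i ∉ T := by simp [hT]
    have hjT : j ∉ T := by simp [hT]
    have key := h T j i hij.symm hjT hiT
    simp only [coMinorWeight_apply, compl_insert] at key
    have hU1 : (insert i (insert j S)).erase i = insert j S :=
      erase_insert (by rw [mem_insert, not_or]; exact ⟨hij, hi⟩)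
    have hU2 : (insert j S).erase j = S := erase_insert hj
    have hU3 : (insert i (insert j S)).erase j = insert i S := by rw [erase_insert_of_ne hij, hU2]
    rw [hTc, hU1, hU2, hU3] at key
    exact key

/-! ## §3 The Gantmacher–Krein–Carlson criterion -/

/-- **The Gantmacher–Krein–Carlson criterion** («a necessary and sufficient condition for a P-matrix to be GKK is
that `A(S,T) A(T,S) ≥ 0` for any `S, T ⊆ [n]` with `|S| = |T| = |S ∪ T| − 1`»; Fallat–Johnson Thm. 6.0.1 for
P-matrices): writing `S ∪ T`-pairs as `U = W ∪ {i}`, `V = W ∪ {j}` (`W = U ∩ V`, `i ≠ j ∉ W`), a P-matrix is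
GKK iff every such pair of symmetrically placed almost principal minors has a nonnegative product — by the
two-bordered Sylvester identity `det A[W∪i] det A[W∪j] − det A[W∪i|W∪j] det A[W∪j|W∪i] = det A[W] det A[W∪{i,j}]`.
[cite: BorceaBrandenLiggett2007, §3.2 (the criterion of [GK], [Ca]); FallatJohnson2011, §6.0 Thm. 6.0.1] -/
theorem isGKK_iff_almostPrincipalMinors_nonneg (hP : IsPMatrix A) :
    IsGKK A ↔ ∀ (S : Finset n) (i j : n), i ≠ j → i ∉ S → j ∉ S →
      0 ≤ (A.submatrix (Sum.elim (Subtype.val : ↥S → n) fun _ : Unit => i)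
              (Sum.elim (Subtype.val : ↥S → n) fun _ : Unit => j)).det *
            (A.submatrix (Sum.elim (Subtype.val : ↥S → n) fun _ : Unit => j)
              (Sum.elim (Subtype.val : ↥S → n) fun _ : Unit => i)).det := by
  rw [isGKK_iff_local hP]
  refine forall_congr' fun S => forall_congr' fun i => forall_congr' fun j => forall_congr' fun hij =>
    forall_congr' fun hi => forall_congr' fun hj => ?_
  rw [← principalMinorMap_insert_mul_insert_sub A hij hi hj, sub_le_self_iff]

end Local

end Literature.Probability.NegativeDependence
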